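import Summits.HodgeConjecture.CorCM.GaloisRightStabiliserDegenerate
import Summits.HodgeConjecture.CorCM.GaloisCosetIntervalTypes
import HarnessLib

/-!
# CYCLIC-BY-MULTIPLIERS Galois groups `C_{2h} ⋊ U` (`U` a faithful group of multipliers avoiding `−1`): the coset
# interval is a primitive degenerate CM type — simple degenerate CM abelian varieties of dimension `h·|U|`

COR-CM (cell `pub-hodgecm2`), binder seat b04 (gen 23), count-neutral claim CYCLIC-BY-MULTIPLIERS, part III (field
level of parts I–II: `CorCM/GaloisRightStabiliserDegenerate`, `CorCM/GaloisCosetIntervalTypes`).  KERNEL ONLY: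
theorems; no definition, no named fact, no `sorry`.  `HC_CM` is neither used nor claimed.

SETTING (inside `G = Gal(K/ℚ)`, `K` Galois CM).  `α ∈ G` of order `2h` (`h ≥ 2`) and a subgroup `U ≤ G` with
`⟨α⟩ ∩ U = 1`, `[K:ℚ] = 2h·|U|` (so `G = ⟨α⟩ ⋊ U`), every `w ∈ U` normalising `⟨α⟩`: `w α w⁻¹ = α^{u_w}`, with
`u_w ≠ 1` for `w ≠ 1` (the multipliers are FAITHFUL) and `u_w ≠ −1` (NO element of `U` inverts `α`), `U ≠ 1`.
Equivalently `G ≅ C_{2h} ⋊ U` for a subgroup `1 ≠ U ≤ (ℤ/2h)ˣ` with `−1 ∉ U`.  Then complex conjugation is `α^h`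
(derived), and the COSET INTERVAL `⊔_{i<h} αⁱ U` is a CM type that is RIGHT-`U`-invariant (degenerate: its reflex field
is the proper subfield `K^U`, part I) and of trivial LEFT stabiliser (primitive, part II).  Hence:

* **`exists_simple_degenerate_of_cyclicByMultipliers`** — `K` has a SIMPLE DEGENERATE abelian variety of dimension
  `h·|U|` with CM by `K`, with an exceptional Hodge class on some power (HC open there).
* **`exists_simple_degenerate_of_cyclicByCyclicMultiplier`** — the case `U = ⟨w⟩` cyclic: `w α = α^{u} w`,
  `⟨w⟩ ∩ ⟨α⟩ = 1`, `[K:ℚ] = 2h · ord w`, `uᵏ ≢ 1` for `0 < k < ord w` and `uᵏ ≢ −1` for all `k`.  For `ord w = 2` this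
  is gen 22 part X (`C_{2h} ⋊_u C₂`, `u ≠ ±1`: semidihedral, modular, `C_m × D_{4n}`, …); NEW are all `|U| ≥ 3`:
  `C₁₆ ⋊ C₄` (`u = 3` or `5`; order 64), `C₃₂ ⋊ C₈`, `C₂₀ ⋊₃ C₄` (order 80), `C₂₄ ⋊ C₂²` (`U = {1,5,7,11}` etc.;
  order 96), `C_{2^k} ⋊ C_{2^s}` (`s ≥ 2`), … — every holomorph-type group `C_{2h} ⋊ U`, `−1 ∉ U ≠ 1`.
  (For `h` odd, `c = α^h` generates a direct factor `C₂` and `K ⊇` an imaginary quadratic field: consistent with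
  gen 19's capstone, e.g. `C₂ × (C₇ ⋊ C₃)`; for `h` even `c` is a square, `K` has no imaginary quadratic subfield,
  and the result is new.)  Seat census `scratch/g23a.py`: rank of the coset interval `= h + 1` of `h|U| + 1` in all
  21 tested groups; left stabiliser trivial iff `−1 ∉ U`.
* When `−1 ∈ U` the coset interval is imprimitive (stabilised by `α^{h−1} w₋₁`); `U = {±1}` is the dihedral group
  (gen 22: good iff `h ≤ 4`), and for `|U| ≥ 4` the seat census finds primitive degenerate types of other shapes
  (`Hol(C₈)`: 17 ∕ 145 sampled) — the sequel.

## References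

* [Shimura1998] G. Shimura, *Abelian Varieties with Complex Multiplication and Modular Functions*, §6.2 Thm. 3,
  §8.2 Prop. 26, §18.2 Lemma (i), §32.10.
* [Gordon1999HodgeAVSurvey] B. B. Gordon, *A survey of the Hodge conjecture for abelian varieties*, Thm. 6.4, §9.3.
* [Kubota1965] T. Kubota, Trans. AMS 118 (1965), §2.
-/

noncomputable section

open CategoryTheory CategoryTheory.Limits NumberField
open scoped BigOperators

namespace Summit.HodgeConjecture.CorCM.GaloisCosetInterval

open Literature.NumberTheory.ComplexMultiplication
open Literature.AlgebraicGeometry.Motives (AbelianVariety CMType)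
open Literature.AlgebraicGeometry.HodgeTheory
open Literature.AlgebraicGeometry.ComplexMultiplication (IsCMTypeRealisation)
open Literature.AlgebraicGeometry.Pohlmann1968
open Literature.Barriers.HodgeConjecture (divisorClassesSpan)
open Summit.HodgeConjecture.CorCM.GaloisModels
open Summit.HodgeConjecture.CorCM.GaloisSemidihedral

/-! ## §1 Cyclic-by-multipliers Galois groups -/

section Field

variable {K : Type} [Field K] [NumberField K] [IsCMField K] [IsGalois ℚ K]

/-- **THEOREM (cyclic-by-multipliers Galois groups `⟨α⟩ ⋊ U`, `−1 ∉ U ≠ 1`).**  `K` Galois CM, `α ∈ Gal(K/ℚ)` of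
order `2h` (`h ≥ 2`), `U ≤ Gal(K/ℚ)` with `⟨α⟩ ∩ U = 1` and `[K:ℚ] = 2h·|U|`, every `w ∈ U` acting on `⟨α⟩` by a
multiplier (`w α = α^{u} w`), trivially only for `w = 1`, never by inversion, and `U ≠ 1`.  Then `K` has a SIMPLE
DEGENERATE abelian variety of dimension `h·|U|` with CM by `K`, with an exceptional Hodge class on some power: the
coset interval `⊔_{i<h} αⁱ U` is a primitive CM type with a non-trivial right stabiliser (complex conjugation `= α^h`
is derived). [cite: Shimura1998, §6.2 Thm. 3, §8.2 Prop. 26 and §32.10] [cite: Gordon1999HodgeAVSurvey, Thm. 6.4]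
[cite: Kubota1965, §2] -/
theorem exists_simple_degenerate_of_cyclicByMultipliers {h : ℕ} (h2 : 2 ≤ h) (α : K ≃ₐ[ℚ] K)
    (U : Subgroup (K ≃ₐ[ℚ] K)) (hord : orderOf α = 2 * h) (hAU : ∀ w ∈ U, w ∈ Subgroup.zpowers α → w = 1)
    (hmult : ∀ w ∈ U, ∃ u : ℕ, w * α = α ^ u * w) (hfaith : ∀ w ∈ U, w * α = α * w → w = 1)
    (hninv : ∀ w ∈ U, w * α * w⁻¹ ≠ α⁻¹) (hU : U ≠ ⊥) (hK : Module.finrank ℚ K = 2 * h * Nat.card U) :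
    ∃ (Φ : CMType K) (φ₀ : K →+* ℂ) (A : AbelianVariety ℂ) (ι : 𝓞 K →+* End A)
      (θ : K →+* Module.End ℂ (complexBetti A.X 1)),
      IsPrimitive (ℂ ≃+* ℂ) Φ.1 φ₀ ∧ ¬ IsNondegenerate Φ ∧ IsCMTypeRealisation Φ A ι θ ∧ A.IsSimple ∧
      A.dim = h * Nat.card U ∧
      ∃ n p : ℕ, ∃ x : complexBetti (⨁ fun _ : Fin n => A).X (2 * p), IsRationalClass x ∧
        IsOfHodgeType (⨁ fun _ : Fin n => A).dim (⨁ fun _ : Fin n => A).X (2 * p) p p x ∧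
        x ∉ divisorClassesSpan (⨁ fun _ : Fin n => A).X (⨁ fun _ : Fin n => A).dim p := by
  classical
  haveI : NeZero h := ⟨by omega⟩
  have hcard : Fintype.card (K ≃ₐ[ℚ] K) = 2 * h * Nat.card U := by
    rw [← hK, ← IsGalois.card_aut_eq_finrank, Nat.card_eq_fintype_card]
  have hc : (IsCMField.complexConj K).restrictScalars ℚ = α ^ h :=
    central_involution_eq_pow_sub (G := K ≃ₐ[ℚ] K) h2 hord hAU hcard hmult hfaith _
      (GaloisRank.model_complexConj_mul_self (MulEquiv.refl _) rfl)
      (GaloisRank.model_complexConj_ne_one (MulEquiv.refl _) rfl)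
      (GaloisRank.model_complexConj_comm (MulEquiv.refl _) rfl)
  obtain ⟨T, hT⟩ := exists_cosetInterval (G := K ≃ₐ[ℚ] K) hord hAU
  obtain ⟨⟨u, huU⟩, hu1⟩ := Subgroup.ne_bot_iff_exists_ne_one.1 hU
  have hu1' : (u : K ≃ₐ[ℚ] K) ≠ 1 := fun h1 => hu1 (Subtype.ext h1)
  have hmain := exists_simple_degenerate_of_model_skew (MulEquiv.refl (K ≃ₐ[ℚ] K)) (α ^ h)
    (by rw [MulEquiv.refl_apply, hc]) T (cosetInterval_cm hord hAU hcard hT)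
    (cosetInterval_leftStabiliser h2 hord hAU hcard hmult hfaith hninv hT) hu1'
    (cosetInterval_mul_right hord hAU hcard hT huU)
  rwa [hcard, show 2 * h * Nat.card U / 2 = h * Nat.card U by
    rw [mul_assoc, Nat.mul_div_cancel_left _ (by norm_num)]] at hmain

end Field

/-! ## §2 The cyclic case `U = ⟨w⟩`: `Gal ≅ C_{2h} ⋊_u C_r` with `−1 ∉ ⟨u⟩` -/

section Cyclic

variable {G : Type*} [Group G] {α w : G} {h u₀ : ℕ}

/-- `wᵏ α = α^{u₀ᵏ} wᵏ`. [folklore] -/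
theorem pow_mul_eq_pow_pow_mul (hrel : w * α = α ^ u₀ * w) (k : ℕ) : w ^ k * α = α ^ (u₀ ^ k) * w ^ k := by
  induction k with
  | zero => simp
  | succ k ih =>
    calc w ^ (k + 1) * α = w ^ k * (w * α) := by rw [pow_succ, mul_assoc]
      _ = w ^ k * α ^ u₀ * w := by rw [hrel, mul_assoc]
      _ = α ^ (u₀ ^ k * u₀) * w ^ k * w := by rw [xi_mul_pow ih u₀]
      _ = α ^ (u₀ ^ (k + 1)) * w ^ (k + 1) := by rw [← pow_succ, mul_assoc, ← pow_succ]

variable {K : Type} [Field K] [NumberField K] [IsCMField K] [IsGalois ℚ K]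

/-- **THEOREM (cyclic complement): `Gal(K/ℚ) = ⟨α⟩ ⋊ ⟨w⟩` with `w α = α^{u} w`, `ord α = 2h` (`h ≥ 2`), `⟨w⟩ ∩ ⟨α⟩ = 1`,
`[K:ℚ] = 2h · ord w`, `w ≠ 1`, `uᵏ ≢ 1 (mod 2h)` for `0 < k < ord w`, and `uᵏ ≢ −1` for all `k`.**  Then `K` has a
SIMPLE DEGENERATE abelian variety of dimension `h · ord w` with CM by `K` (exceptional Hodge classes on a power).
For `ord w = 2` this is gen 22 part X; `ord w ≥ 3` (e.g. `C₁₆ ⋊₃ C₄`, `C₂₀ ⋊₃ C₄`, `C₃₂ ⋊₃ C₈`) is new.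
[cite: Shimura1998, §6.2 Thm. 3, §8.2 Prop. 26 and §32.10] [cite: Gordon1999HodgeAVSurvey, Thm. 6.4] -/
theorem exists_simple_degenerate_of_cyclicByCyclicMultiplier {h u₀ : ℕ} (h2 : 2 ≤ h) (α w : K ≃ₐ[ℚ] K)
    (hord : orderOf α = 2 * h) (hrel : w * α = α ^ u₀ * w)
    (hwA : ∀ k : ℕ, w ^ k ∈ Subgroup.zpowers α → w ^ k = 1) (hw : w ≠ 1)
    (hfaith : ∀ k : ℕ, 0 < k → k < orderOf w → ((u₀ ^ k : ℕ) : ZMod (2 * h)) ≠ 1)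
    (hninv : ∀ k : ℕ, ((u₀ ^ k : ℕ) : ZMod (2 * h)) ≠ -1) (hK : Module.finrank ℚ K = 2 * h * orderOf w) :
    ∃ (Φ : CMType K) (φ₀ : K →+* ℂ) (A : AbelianVariety ℂ) (ι : 𝓞 K →+* End A)
      (θ : K →+* Module.End ℂ (complexBetti A.X 1)),
      IsPrimitive (ℂ ≃+* ℂ) Φ.1 φ₀ ∧ ¬ IsNondegenerate Φ ∧ IsCMTypeRealisation Φ A ι θ ∧ A.IsSimple ∧
      A.dim = h * orderOf w ∧
      ∃ n p : ℕ, ∃ x : complexBetti (⨁ fun _ : Fin n => A).X (2 * p), IsRationalClass x ∧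
        IsOfHodgeType (⨁ fun _ : Fin n => A).dim (⨁ fun _ : Fin n => A).X (2 * p) p p x ∧
        x ∉ divisorClassesSpan (⨁ fun _ : Fin n => A).X (⨁ fun _ : Fin n => A).dim p := by
  classical
  haveI : NeZero h := ⟨by omega⟩
  haveI : NeZero (2 * h) := ⟨by omega⟩
  -- every element of `⟨w⟩` is `wᵏ` with `k < ord w`
  have hmem : ∀ x ∈ Subgroup.zpowers w, ∃ k : ℕ, k < orderOf w ∧ x = w ^ k := fun x hx => by
    rw [(isOfFinOrder_of_finite w).mem_zpowers_iff_mem_range_orderOf, Finset.mem_image] at hx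
    obtain ⟨k, hk, rfl⟩ := hx
    exact ⟨k, Finset.mem_range.1 hk, rfl⟩
  -- `α^{u₀ᵏ} = α` forces `u₀ᵏ ≡ 1`
  have hcong : ∀ k : ℕ, α ^ (u₀ ^ k) = α → ((u₀ ^ k : ℕ) : ZMod (2 * h)) = 1 := fun k hk => by
    have h1 : α ^ (u₀ ^ k) = α ^ (1 : ℕ) := by rw [pow_one]; exact hk
    rw [pow_eq_pow_iff_modEq, hord] at h1
    have := (ZMod.natCast_eq_natCast_iff' (u₀ ^ k) 1 (2 * h)).2 h1
    rwa [Nat.cast_one] at this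
  have hres := exists_simple_degenerate_of_cyclicByMultipliers h2 α (Subgroup.zpowers w) hord
    (fun x hx hxα => by
      obtain ⟨k, -, rfl⟩ := hmem x hx
      exact hwA k hxα)
    (fun x hx => by
      obtain ⟨k, -, rfl⟩ := hmem x hx
      exact ⟨u₀ ^ k, pow_mul_eq_pow_pow_mul hrel k⟩)
    (fun x hx hcomm => by
      obtain ⟨k, hk, rfl⟩ := hmem x hx
      rcases Nat.eq_zero_or_pos k with rfl | hk0
      · rw [pow_zero]
      · exfalso
        refine hfaith k hk0 hk (hcong k ?_)
        have h1 := pow_mul_eq_pow_pow_mul hrel k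
        rw [hcomm] at h1
        exact (mul_right_cancel h1).symm)
    (fun x hx hinv => by
      obtain ⟨k, -, rfl⟩ := hmem x hx
      apply hninv k
      have h1 := pow_mul_eq_pow_pow_mul hrel k
      rw [← mul_inv_eq_iff_eq_mul, hinv] at h1
      -- `α⁻¹ = α^{u₀ᵏ}`: so `α^{u₀ᵏ + 1} = 1`
      have h3 : α ^ (u₀ ^ k + 1) = α ^ (0 : ℕ) := by rw [pow_succ, ← h1, inv_mul_cancel, pow_zero]
      rw [pow_eq_pow_iff_modEq, hord] at h3
      have h4 := (ZMod.natCast_eq_natCast_iff' (u₀ ^ k + 1) 0 (2 * h)).2 h3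
      rw [Nat.cast_add, Nat.cast_one, Nat.cast_zero] at h4
      exact eq_neg_of_add_eq_zero_left h4)
    ((Subgroup.zpowers_ne_bot).2 hw) (by rw [hK, Nat.card_zpowers])
  rwa [Nat.card_zpowers] at hres

end Cyclic

end Summit.HodgeConjecture.CorCM.GaloisCosetInterval

end
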